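import Summits.NavierStokesRegularity.FunctionalMining.NoGo.StretchingStrainL4FloorField
import HarnessLib

/-!
# Functional mining (K1-Q1, door D2a), part 2 of 2: the FLOOR of the `L⁴` Calderón–Zygmund door — `K⋆₄ ≥ 1/4` unconditionally, `K⋆₄ ≥ 81/4` conditional on one published multiplier norm

Search for candidate a priori estimates; no regularity claim.

Cell `pub-nsfunc`, dict(+lead) seat (gen 10; split into two files by gen 11 for the 400-line cap), STAGED for a prover-role seat (target tree path
`Summits/NavierStokesRegularity/FunctionalMining/NoGo/StretchingStrainL4Floor.lean`). Kernel form of the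
no-go seat's paper-level THEOREM K4 (`HOME/pub-nsfunc-nogo/KSTAR4.md` [ours, UNREVIEWED by a journal;
referee round 27 hand-rederived]) and the companion of the dict seat's staged conditional CEILING
`NoGo/StretchingSupExplicit.lean`. Static facts about smooth divergence-free fields on the flat torus
`𝕋³` only; nothing is asserted about Navier–Stokes solutions or their regularity.

PARTS. Part 1 = `NoGo/StretchingStrainL4FloorField.lean` (imported here): the operators `lap`/`box`/`strainSq`, the
hypothesis shape `SecondRieszQuarticLower`, the planar stream field `field ψ` with its strain/vorticity densities, and
the unconditional transfer `quarter_integral_box_le`. This part: the unconditional rung `SecondRieszQuarticLower 1`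
(witness `ψ₁ = cos 2πy₀`) and the floor theorems.

THE DOOR. The tree theorem `stretchingSupBound_of_strainL4Bound` (`NoGo/StretchingSupNotSharpCore`): a
constant `K ≥ 0` in the quartic strain/vorticity inequality `∫_{𝕋³}|S|_F⁴ ≤ K ∫_{𝕋³}|ω|⁴` for all smooth
divergence-free fields (`StrainL4Bound K`, `NoGo/StretchingHolderDeficit`) yields the static stretching
bound with the constant `2/√3 − 1/(4√3(4K+1))`, strictly below Hölder's `2/√3`. How far below Hölder can
THIS door reach? Exactly as far as `K⋆₄ := inf {K : StrainL4Bound K}` allows.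

THEOREM (this file). `SecondRieszQuarticLower 3 → StrainL4Bound (d := Fin 3) K → 81/4 ≤ K`
(`strainL4Bound_ge_of_three`; general constant: `SecondRieszQuarticLower a → … → a⁴/4 ≤ K`,
`strainL4Bound_ge`); hence, for every admissible `K`, the door's constant is at least
`2/√3 − 1/(328√3) ≈ 1.1529403` (`door_const_ge`): the `L⁴` Calderón–Zygmund door certifies no static
stretching constant below `2/√3 − 1/(328√3)` — its whole range lies inside `[2/√3 − 1/(328√3), 2/√3)`,
width `≈ 1.76·10⁻³`, far above the kernel lower bound `(2+√5)/8 ≈ 0.5295 ≤ C⋆` of the constant itself.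
UNCONDITIONAL PART (no hypothesis): for every smooth `ψ` on `𝕋²`,
`StrainL4Bound K → ¼ ∫_{𝕋²} ((∂₀² − ∂₁²)ψ)⁴ ≤ K ∫_{𝕋²} (Δψ)⁴` (`quarter_integral_box_le`), i.e.
`4K ≥ ‖(∂₀² − ∂₁²)Δ⁻¹‖⁴_{L⁴_0(𝕋²) → L⁴(𝕋²)}` in the sense of smooth test functions.

THE ONE INPUT, used as a HYPOTHESIS (`SecondRieszQuarticLower 3`, nothing asserted): for every `c < 81`
some smooth `ψ : 𝕋² → ℝ` has `∫(Δψ)⁴ > 0` and `c ∫(Δψ)⁴ ≤ ∫((∂₀² − ∂₁²)ψ)⁴`. IN PRINT this is the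
lower bound `‖R₁² − R₂²‖_{L^p(ℝ²) → L^p(ℝ²)} ≥ p* − 1` at `p = 4` (`p* − 1 = 3`, `3⁴ = 81`) of
Geiss–Montgomery-Smith–Saksman, Trans. Amer. Math. Soc. 362 (2010) 553–575 (arXiv:math/0701516),
Corollary 1.1 (with equality; the upper bound is Nazarov–Volberg's), transferred to mean-zero functions on
the torus by their Lemma 2.2 (the `L^p(ℝⁿ)` norm of a multiplier that is homogeneous of degree `0` and
smooth off the origin equals its norm on `L^p_0(𝕋ⁿ)`), together with the symbol identity
`(R₁² − R₂²)Δψ = −(∂₁² − ∂₂²)ψ` and the density of trigonometric polynomials (every mean-zero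
trigonometric polynomial is `Δψ`). It is NOT a tree fact yet; a literature seat is to type it under
`Literature/` with its citation tag, after which `(h : SecondRieszQuarticLower 3)` below is discharged by it.
No internally-minted statement enters as a cited fact: the hypothesis is displayed, never asserted.

MECHANISM (planar stream fields; Majda–Bertozzi 2002 §2.3.1). For smooth `ψ` on `𝕋²` the
`2½`-dimensional field `u = (−∂₁ψ, ∂₀ψ, 0)(x₀,x₁)` (tree `Torus.twoHalf`) is smooth and divergence free
(`∂₀∂₁ = ∂₁∂₀`, tree `Torus.partialDeriv_comm`), with, pointwise at `y = πx`,
`|S|_F² = (∂₀∂₁ψ)² + (∂₁∂₀ψ)² + ½((∂₀² − ∂₁²)ψ)²` (`strainNormSqAt_field`) and `|ω|² = (Δψ)²`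
(`torusVorticitySqAt_field`). Hence `|S|_F⁴ ≥ ¼((∂₀² − ∂₁²)ψ)⁴`, and integrating over `𝕋³ = 𝕋¹ × 𝕋²`
(tree `Torus.integral_comp_planarProj`) `StrainL4Bound K` gives `¼∫(□ψ)⁴ ≤ K∫(Δψ)⁴`, `□ := ∂₀² − ∂₁²`;
the hypothesis at `c = (4K + 81)/2` then forces `81 ≤ 4K`. ALSO PROVED, with no hypothesis at
all: the rung `SecondRieszQuarticLower 1` (witness `ψ₁ = cos 2πy₀`, `□ψ₁ = Δψ₁`; `secondRieszQuarticLower_one`),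
hence the UNCONDITIONAL floor `K⋆₄ ≥ 1/4` (`strainL4Bound_ge_quarter`) and the unconditional door floor
`2/√3 − 1/(8√3) = 15/(8√3) > 1.0825` (`door_const_ge_uncond`, `door_floor_uncond_gt`).

References: S. Geiss, S. Montgomery-Smith, E. Saksman, Trans. AMS 362 (2010), Cor. 1.1, Lemma 2.2
(arXiv:math/0701516); F. Nazarov, A. Volberg, Algebra i Analiz 15 (2003) (upper bound);
R. Bañuelos, P. Méndez-Hernández, Indiana Univ. Math. J. 52 (2003) (the companion `‖R₁R₂‖_p`, `‖Rⱼ²‖_p`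
bounds used by the CEILING file); A. Majda, A. Bertozzi, *Vorticity and Incompressible Flow* (CUP 2002)
§2.3.1. Cell documents: `HOME/pub-nsfunc-nogo/KSTAR4.md`, `HOME/pub-nsfunc-dict/K1Q1-LADDER.md` §B,
`HOME/DICTIONARY.md` §14 row D2a, `HOME/dict/K0-FLAGS.json` A8.explicit_deficit.
-/

noncomputable section

open MeasureTheory Set Filter Topology Function
open scoped InnerProductSpace ContDiff

namespace Summit.NavierStokesRegularity.FunctionalMining

open Literature.Analysis Literature.Analysis.FunctionSpaces Literature.Analysis.FunctionSpaces.Torus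
open Literature.Analysis.FluidPDE Literature.Analysis.FluidPDE.Torus

namespace StrainL4Floor

section Rung
/-! ## The unconditional rung `SecondRieszQuarticLower 1` — witness `ψ₁ = cos 2πy₀` -/

/-- The planar frequency `(1, 0)`. [ours — K1-Q1 door D2a] -/
def m10 : Fin 2 → ℤ := ![1, 0]

/-- The witness `ψ₁(y) = Re e_{(1,0)}(y) = cos 2πy₀` (real part of a Fourier character). [ours — K1-Q1
door D2a] -/
def ψ₁ (y : UnitAddTorus (Fin 2)) : ℝ := Complex.reCLM (UnitAddTorus.mFourier m10 y)

/-- `ψ₁` is smooth. [folklore] -/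
theorem isSmooth_ψ₁ : Torus.IsSmooth ψ₁ := (isSmooth_mFourier m10).comp_clm Complex.reCLM

/-- The character `e_{(1,0)}` is `C¹`. [folklore] -/
theorem isContDiff_mFourier_m10 :
    Torus.IsContDiff 1 (⇑(UnitAddTorus.mFourier m10) : UnitAddTorus (Fin 2) → ℂ) :=
  (isSmooth_mFourier m10).isContDiff (by simp)

/-- Post-composition with a continuous linear map commutes with partial derivatives of `C¹` maps
(chain rule on the re-centred lift). [folklore] -/
theorem partialDeriv_clm_apply {G H : Type*} [NormedAddCommGroup G] [NormedSpace ℝ G]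
    [NormedAddCommGroup H] [NormedSpace ℝ H] {f : UnitAddTorus (Fin 2) → G}
    (hf : Torus.IsContDiff 1 f) (L : G →L[ℝ] H) (j : Fin 2) (x : UnitAddTorus (Fin 2)) :
    Torus.partialDeriv j (fun y => L (f y)) x = L (Torus.partialDeriv j f x) := by
  have hf' : Torus.IsContDiff 1 (fun y => L (f y)) := L.contDiff.comp hf
  have hd : DifferentiableAt ℝ (liftAt f x) 0 :=
    ((hf.liftAt x).differentiable one_ne_zero).differentiableAt
  have h : liftAt (fun y => L (f y)) x = (L : G → H) ∘ liftAt f x := rfl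
  rw [partialDeriv_eq_fderiv_apply hf', partialDeriv_eq_fderiv_apply hf, Torus.fderiv, Torus.fderiv, h,
    (L.hasFDerivAt.comp (0 : EuclideanSpace ℝ (Fin 2)) hd.hasFDerivAt).fderiv]
  rfl

/-- `∂₁ψ₁ = 0` (`ψ₁` depends on `y₀` only). [ours — K1-Q1 door D2a] -/
theorem partialDeriv_one_ψ₁ : Torus.partialDeriv 1 ψ₁ = fun _ => 0 := by
  funext x
  unfold ψ₁
  rw [partialDeriv_clm_apply (f := (⇑(UnitAddTorus.mFourier m10) : UnitAddTorus (Fin 2) → ℂ))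
    isContDiff_mFourier_m10 Complex.reCLM 1 x, partialDeriv_mFourier]
  simp [m10]

/-- `∂₀ψ₁ = −2π · Im e_{(1,0)}`. [ours — K1-Q1 door D2a] -/
theorem partialDeriv_zero_ψ₁ :
    Torus.partialDeriv 0 ψ₁ = (-(2 * Real.pi)) • fun y => Complex.imCLM (UnitAddTorus.mFourier m10 y) := by
  funext x
  unfold ψ₁
  rw [partialDeriv_clm_apply (f := (⇑(UnitAddTorus.mFourier m10) : UnitAddTorus (Fin 2) → ℂ))
    isContDiff_mFourier_m10 Complex.reCLM 0 x, partialDeriv_mFourier]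
  simp [m10, Complex.mul_re, Complex.mul_im]

/-- `∂₀∂₀ψ₁ = −4π² ψ₁`. [ours — K1-Q1 door D2a] -/
theorem partialDeriv_zero_zero_ψ₁ (x : UnitAddTorus (Fin 2)) :
    Torus.partialDeriv 0 (Torus.partialDeriv 0 ψ₁) x = -(4 * Real.pi ^ 2) * ψ₁ x := by
  have hg : Torus.IsContDiff 1 (fun y : UnitAddTorus (Fin 2) => Complex.imCLM (UnitAddTorus.mFourier m10 y)) :=
    Complex.imCLM.contDiff.comp isContDiff_mFourier_m10
  rw [partialDeriv_zero_ψ₁, partialDeriv_const_smul hg, Pi.smul_apply,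
    partialDeriv_clm_apply (f := (⇑(UnitAddTorus.mFourier m10) : UnitAddTorus (Fin 2) → ℂ))
      isContDiff_mFourier_m10 Complex.imCLM 0 x, partialDeriv_mFourier]
  unfold ψ₁
  simp [m10, Complex.mul_re, Complex.mul_im]
  ring

/-- `∂₁∂₁ψ₁ = 0`. [ours — K1-Q1 door D2a] -/
theorem partialDeriv_one_one_ψ₁ (x : UnitAddTorus (Fin 2)) :
    Torus.partialDeriv 1 (Torus.partialDeriv 1 ψ₁) x = 0 := by
  rw [partialDeriv_one_ψ₁, CellularStretching.partialDeriv_const_eq_zero]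

/-- For the one-variable witness, `□ψ₁ = Δψ₁`. [ours — K1-Q1 door D2a] -/
theorem box_ψ₁_eq_lap : box ψ₁ = lap ψ₁ := by
  funext y
  unfold box lap
  rw [partialDeriv_one_one_ψ₁]
  ring

/-- `ψ₁(0) = 1`. [ours — K1-Q1 door D2a] -/
theorem ψ₁_zero : ψ₁ 0 = 1 := by
  unfold ψ₁
  simp [UnitAddTorus.mFourier]

/-- `Δψ₁(0) = −4π²`. [ours — K1-Q1 door D2a] -/
theorem lap_ψ₁_zero : lap ψ₁ 0 = -(4 * Real.pi ^ 2) := by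
  unfold lap
  rw [partialDeriv_zero_zero_ψ₁, partialDeriv_one_one_ψ₁, ψ₁_zero]
  ring

/-- `∫(Δψ₁)⁴ > 0` (continuous nonnegative integrand, nonzero at `0`, open sets of the torus have
positive Haar measure). [ours — K1-Q1 door D2a] -/
theorem integral_lap_ψ₁_four_pos : 0 < ∫ y, lap ψ₁ y ^ 4 := by
  refine ((continuous_lap isSmooth_ψ₁).pow 4).integral_pos_of_hasCompactSupport_nonneg_nonzero
    (HasCompactSupport.of_compactSpace _) (fun y => (by positivity : (0 : ℝ) ≤ lap ψ₁ y ^ 4)) (x := 0) ?_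
  rw [lap_ψ₁_zero]
  exact pow_ne_zero _ (neg_ne_zero.2 (by positivity))

/-- **THE UNCONDITIONAL RUNG `SecondRieszQuarticLower 1`:** for every `c < 1` the witness
`ψ₁ = cos 2πy₀` has `∫(Δψ₁)⁴ > 0` and `c∫(Δψ₁)⁴ ≤ ∫(□ψ₁)⁴ = ∫(Δψ₁)⁴`. No literature input.
[ours — K1-Q1 door D2a] -/
theorem secondRieszQuarticLower_one : SecondRieszQuarticLower 1 := by
  intro c hc
  refine ⟨ψ₁, isSmooth_ψ₁, integral_lap_ψ₁_four_pos, ?_⟩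
  rw [box_ψ₁_eq_lap]
  have hc1 : c < 1 := by simpa using hc
  nlinarith [integral_lap_ψ₁_four_pos]

end Rung

/-- **FLOOR TRANSFER (general constant):** a quartic lower bound `a` for `(∂₀² − ∂₁²)Δ⁻¹` on `𝕋²`
forces `K ≥ a⁴/4` in `StrainL4Bound K`. Proof: `quarter_integral_box_le` gives `¼∫(□ψ)⁴ ≤ K∫(Δψ)⁴` for
every smooth `ψ`; the hypothesis at `c = (4K + a⁴)/2 < a⁴` supplies a `ψ` with `∫(Δψ)⁴ > 0` and
`c∫(Δψ)⁴ ≤ ∫(□ψ)⁴ ≤ 4K∫(Δψ)⁴`, so `c ≤ 4K`, i.e. `a⁴ ≤ 4K`. Search for candidate a priori estimates; no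
regularity claim. [ours — K1-Q1 door D2a] -/
theorem strainL4Bound_ge {a : ℝ} (h : SecondRieszQuarticLower a) {K : ℝ}
    (hK : StrainL4Bound (d := Fin 3) K) : a ^ 4 / 4 ≤ K := by
  by_contra hle
  have hlt : K < a ^ 4 / 4 := not_le.mp hle
  obtain ⟨ψ, hψ, hpos, hc⟩ := h ((4 * K + a ^ 4) / 2) (by linarith)
  have h4 := quarter_integral_box_le hψ hK
  nlinarith [mul_pos (sub_pos.2 hlt) hpos, hc, h4]

/-- **THE FLOOR OF THE `L⁴` CALDERÓN–ZYGMUND DOOR (conditional on the published multiplier norm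
`‖R₁² − R₂²‖₄ = 3`):** `SecondRieszQuarticLower 3 → StrainL4Bound (d := Fin 3) K → 81/4 ≤ K`, i.e.
`K⋆₄ ≥ 81/4 = 3⁴/4` — the kernel form of the no-go seat's THEOREM K4. Since the published constant `3` is
sharp (Nazarov–Volberg), `81/4` is all that the `□`-part of planar stream fields yields; the full planar
strain `½|𝔅Δψ|²`, `𝔅 = R₂² − R₁² + 2iR₁R₂`, would give `‖𝔅‖₄⁴/4`, `= 81/4` again under Iwaniec's
conjecture `‖𝔅‖_p = p* − 1`. Search for candidate a priori estimates; no regularity claim.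
[ours — K1-Q1 door D2a; the input arXiv:math/0701516 Cor. 1.1 + Lemma 2.2 enters as a hypothesis] -/
theorem strainL4Bound_ge_of_three (h : SecondRieszQuarticLower 3) {K : ℝ}
    (hK : StrainL4Bound (d := Fin 3) K) : (81 : ℝ) / 4 ≤ K := by
  have h' := strainL4Bound_ge h hK
  norm_num at h'
  exact h'

/-- **No `K < 81/4` is admissible** (contrapositive form). [ours — K1-Q1 door D2a] -/
theorem not_strainL4Bound_of_lt (h : SecondRieszQuarticLower 3) {K : ℝ} (hK : K < 81 / 4) :
    ¬ StrainL4Bound (d := Fin 3) K :=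
  fun hB => absurd (strainL4Bound_ge_of_three h hB) (not_le.2 hK)

/-- **THE DOOR'S RANGE HAS A FLOOR**: for every admissible `K` the constant delivered by the tree door
`stretchingSupBound_of_strainL4Bound`, namely `2/√3 − 1/(4√3(4K+1))`, is at least
`2/√3 − 1/(328√3) ≈ 1.1529403` (`4K + 1 ≥ 82`). So the `L⁴` Calderón–Zygmund door proves "`2/√3` is not
sharp" and nothing quantitatively better than a margin `≤ 1/(328√3) ≈ 1.76·10⁻³`; deciding the value
of `C⋆ ∈ [(2+√5)/8, 2/√3)` needs a different door. Search for candidate a priori estimates; no regularity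
claim. [ours — K1-Q1 door D2a] -/
theorem door_const_ge (h : SecondRieszQuarticLower 3) {K : ℝ} (hK : StrainL4Bound (d := Fin 3) K) :
    2 / Real.sqrt 3 - 1 / (328 * Real.sqrt 3) ≤ 2 / Real.sqrt 3 - 1 / (4 * Real.sqrt 3 * (4 * K + 1)) := by
  have hK' := strainL4Bound_ge_of_three h hK
  have hs : 0 < Real.sqrt 3 := Real.sqrt_pos.2 (by norm_num)
  have h82 : (328 : ℝ) * Real.sqrt 3 ≤ 4 * Real.sqrt 3 * (4 * K + 1) := by nlinarith
  have hd : 1 / (4 * Real.sqrt 3 * (4 * K + 1)) ≤ 1 / (328 * Real.sqrt 3) :=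
    one_div_le_one_div_of_le (by positivity) h82
  linarith

/-- **Numerical value of the floor**: `2/√3 − 1/(328√3) > 1.1529` (and `< 2/√3 < 1.1548`). [ours; arithmetic] -/
theorem door_floor_gt : (1.1529 : ℝ) < 2 / Real.sqrt 3 - 1 / (328 * Real.sqrt 3) := by
  have hs : 0 < Real.sqrt 3 := Real.sqrt_pos.2 (by norm_num)
  have hs2 : Real.sqrt 3 ^ 2 = 3 := Real.sq_sqrt (by norm_num)
  -- `2/√3 − 1/(328√3) = 655/(328√3)` and `655² = 429025 > 3·(328·1.1529)² = 428986.6…`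
  have hs0 : Real.sqrt 3 ≠ 0 := hs.ne'
  have hlt : (1.1529 : ℝ) * (328 * Real.sqrt 3) < 655 := by nlinarith [mul_pos hs hs]
  have heq : 2 / Real.sqrt 3 - 1 / (328 * Real.sqrt 3) = 655 / (328 * Real.sqrt 3) := by
    field_simp
    ring
  rw [heq, lt_div_iff₀ (by positivity)]
  exact hlt

/-- **UNCONDITIONAL FLOOR `K⋆₄ ≥ 1/4`:** every admissible constant of `StrainL4Bound (d := Fin 3)`
satisfies `1/4 ≤ K` — from the rung `SecondRieszQuarticLower 1` (witness `cos 2πy₀`), no hypothesis.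
Search for candidate a priori estimates; no regularity claim. [ours — K1-Q1 door D2a] -/
theorem strainL4Bound_ge_quarter {K : ℝ} (hK : StrainL4Bound (d := Fin 3) K) : (1 : ℝ) / 4 ≤ K := by
  have h := strainL4Bound_ge secondRieszQuarticLower_one hK
  norm_num at h
  linarith

/-- **UNCONDITIONAL DOOR FLOOR:** the `L⁴` Calderón–Zygmund door can never certify a stretching constant
below `2/√3 − 1/(8√3) = 15/(8√3) ≈ 1.08253` — no hypothesis. [ours — K1-Q1 door D2a] -/
theorem door_const_ge_uncond {K : ℝ} (hK : StrainL4Bound (d := Fin 3) K) :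
    2 / Real.sqrt 3 - 1 / (8 * Real.sqrt 3) ≤ 2 / Real.sqrt 3 - 1 / (4 * Real.sqrt 3 * (4 * K + 1)) := by
  have hK' := strainL4Bound_ge_quarter hK
  have hs : 0 < Real.sqrt 3 := Real.sqrt_pos.2 (by norm_num)
  have h8 : (8 : ℝ) * Real.sqrt 3 ≤ 4 * Real.sqrt 3 * (4 * K + 1) := by nlinarith
  have hd : 1 / (4 * Real.sqrt 3 * (4 * K + 1)) ≤ 1 / (8 * Real.sqrt 3) :=
    one_div_le_one_div_of_le (by positivity) h8
  linarith

/-- Numerical value of the unconditional door floor: `2/√3 − 1/(8√3) > 1.0825`. [ours] -/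
theorem door_floor_uncond_gt : (1.0825 : ℝ) < 2 / Real.sqrt 3 - 1 / (8 * Real.sqrt 3) := by
  have hs : 0 < Real.sqrt 3 := Real.sqrt_pos.2 (by norm_num)
  have hs2 : Real.sqrt 3 ^ 2 = 3 := Real.sq_sqrt (by norm_num)
  have hs0 : Real.sqrt 3 ≠ 0 := hs.ne'
  have hlt : (1.0825 : ℝ) * (8 * Real.sqrt 3) < 15 := by nlinarith [mul_pos hs hs]
  have heq : 2 / Real.sqrt 3 - 1 / (8 * Real.sqrt 3) = 15 / (8 * Real.sqrt 3) := by
    field_simp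
    ring
  rw [heq, lt_div_iff₀ (by positivity)]
  exact hlt


end StrainL4Floor

end Summit.NavierStokesRegularity.FunctionalMining

end
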